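import Literature.IUT.LogThetaLattice.GlobalFrobenioidModels
import Mathlib.Algebra.Ring.Subring.Units
import HarnessLib

/-!
# [IUTchIII] Remark 3.6.2 (i): the UNPRIMED schema `Remark362i_Sunits` is refutable (kernel record)

Negative companion (abc-iut cell, L6 ruling D10 (c); FACT-LIST rule R5 «refuted is never a fact», row
F-0427 `Remark362i_Sunits` — admissible · witness-candidate at the 00:30Z freeze) of abc-iut-L6-t4's
`GlobalFrobenioidModels.lean`. S. Mochizuki, *Inter-universal Teichmüller Theory III*, Remark 3.6.2 (i),
kurims p. 109 [claim: Mochizuki2012, status: disputed]: sets of `S`-units "do not satisfy the fundamental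
property" of being additively closed. The first typing
`Remark362i_Sunits US := US ≠ ⊤ → ¬ IsAdditivelyClosed F {x | ∃ u ∈ US, ↑u = x}` quantifies over an
ARBITRARY proper subgroup `US ⊊ F^×` of an arbitrary field; abc-iut-L6-t4's own RQ7 review recorded it as
FALSE-AS-TYPED and appended the repaired `Remark362i_Sunits'` (hypothesis: some positive integer is not in
`US`), PROVED as `Remark362i_Sunits'_holds` (p405528). This file lands the KERNEL WITNESS that was still
missing for R5: in `F := ℚ` the proper subgroup of POSITIVE units (Mathlib `Units.posSubgroup ℚ`;
`-1 ∉`) has `US ∪ {0} = ℚ_{≥0}`, which IS closed under addition — so `Remark362i_Sunits (Units.posSubgroup ℚ)`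
is false, and the universal closure of the schema is refutable. Nothing here bears on Mochizuki's remark
(which concerns `S`-unit groups of a number field, the primed form) or on Cor. 3.12; typing record only;
no side taken.
-/

namespace Literature.IUT.LogThetaLattice

namespace GlobalFrobenioidModels

/-- **IUTchIII:Rmk3.6.2(i)** (kurims p.109) the unprimed schema FAILS at `F := ℚ`,
`US := Units.posSubgroup ℚ` (the positive rationals): a proper subgroup (`-1` is not positive) whose
underlying set together with `0` is closed under addition. [claim: Mochizuki2012, status: disputed] -/
theorem not_Remark362i_Sunits_posSubgroup : ¬ Remark362i_Sunits (F := ℚ) (Units.posSubgroup ℚ) := by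
  intro h
  have hne : Units.posSubgroup ℚ ≠ ⊤ := by
    intro htop
    have hmem : (-1 : ℚˣ) ∈ Units.posSubgroup ℚ := htop ▸ Subgroup.mem_top _
    rw [Units.mem_posSubgroup] at hmem
    norm_num at hmem
  refine h hne ?_
  -- `{x | ∃ u ∈ posSubgroup, ↑u = x} ∪ {0}` = the nonnegative rationals, closed under `+`
  have hset : ∀ a : ℚ, a ∈ {x : ℚ | ∃ u ∈ Units.posSubgroup ℚ, (u : ℚ) = x} ∪ {0} ↔ 0 ≤ a := by
    intro a
    simp only [Set.mem_union, Set.mem_setOf_eq, Set.mem_singleton_iff, Units.mem_posSubgroup]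
    constructor
    · rintro (⟨u, hu, rfl⟩ | rfl)
      · exact hu.le
      · exact le_rfl
    · intro ha
      rcases ha.lt_or_eq with hlt | heq
      · exact Or.inl ⟨Units.mk0 a hlt.ne', by simpa using hlt, rfl⟩
      · exact Or.inr heq.symm
  intro a ha b hb
  rw [hset] at ha hb ⊢
  exact add_nonneg ha hb

/-- **IUTchIII:Rmk3.6.2(i)** (kurims p.109) hence the UNIVERSAL closure of the unprimed schema is
refutable; consumers use the repaired `Remark362i_Sunits'` (PROVED, `Remark362i_Sunits'_holds`).
[claim: Mochizuki2012, status: disputed] -/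
theorem not_forall_Remark362i_Sunits :
    ¬ ∀ (F : Type) (_ : Field F) (US : Subgroup Fˣ), Remark362i_Sunits (F := F) US :=
  fun h => not_Remark362i_Sunits_posSubgroup (h ℚ inferInstance (Units.posSubgroup ℚ))

end GlobalFrobenioidModels

end Literature.IUT.LogThetaLattice
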